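import Literature.AlgebraicGeometry.AbelianSchemes.WeilUnitOfTorsionPoint
import Literature.AlgebraicGeometry.AbelianSchemes.TorsionSectionPairingDualIsogeny
import HarnessLib

/-!
# The Weil unit is natural in homomorphisms: `e_n^A(x, φ^∨ ŷ) = e_n^B(φ x, ŷ)` ([Mumford AV] §20 (I), p. 186)

Topic `Literature/AlgebraicGeometry/AbelianSchemes`; namespaces `Literature.AlgebraicGeometry.AbelianSchemes.AbelianSchemeOver` (§1) and
`….AbelianSchemeOver.DualPair` (§2).  Theorems only (no `def`, no named fact, no instance, no notation, no `sorry`).  Cell `hodgecm-mathlib` (D-0151),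
FLOOR 0, P6 «MOD programme» (crux hLiu418 = stmt-HodgeConjecture-24832), W-line `Cruxes/HLiu418/Lines/F0_P6b_WeilCartierDuality.lean` letter `stub_W1`
«WeilPairingNatural», σ1 road (memo `F0/P6/B-p08/g32/ROAD-sigma1-WeilPairingNatural.v1.B-p08g32.md`), organ (σ1-e) in the `weilUnit` costume that (σ1-f)
consumes: the sequel of ★ `WeilUnitOfTorsionPoint` (the function `weilUnit`) and ★ `TorsionSectionPairingDualIsogeny` (the heart
`pairingUnit_eq_of_dualIsogeny`, for VARIABLE intertwined actions).  HC_CM is proved only modulo the printed citations until rung 0 closes; nothing here is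
about HC.

THE PRINT.  [MumfordAV1970] §20 p. 186, property (I) of the pairing `e_n : X_n × X̂_n → μ_n`: «if `f : X → Y` is a homomorphism, then `e_n(f(x), y) =
e_n(x, f̂(y))` for `x ∈ X_n`, `y ∈ Ŷ_n`»; [MilneAV2008] I §11 (the `e_m`-pairing; functoriality in homomorphisms).  Here, scheme-theoretically over a test
scheme `T → S`: `φ : A → B` a homomorphism of abelian `S`-schemes (`S` reduced, locally Noetherian), `(Â, 𝒫_A)`, `(B̂, 𝒫_B)` dual pairs with the unit
hypotheses, `φ^∨ : B̂ → Â` the dual homomorphism (★ `DualPair.dualIsogenyOver`), `ŷ = c` an `n`-torsion `T`-point of `B̂`, `x` an `n`-torsion section of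
`A_T`; then the Weil unit of `x` against `φ^∨ ŷ` equals the Weil unit of the section `φ_T x` of `B_T` against `ŷ`, in `Γ(T, 𝒪_T)`.

THE PROOF.  ★ `TorsionPairing.pairingUnit_eq_of_dualIsogeny` compares the pairing units of ANY two actions of one group `K` on `A_T` over `[n]` and on
`B_T` over `[n]` intertwined by `φ_T`; take `K := A_T[n](T)`, `ρ_A :=` its translation action (★ `translationActionMulN`, the action inside `weilUnit`),
`ρ_B :=` the translation action of `B_T` by the `φ_T`-images (★ `translationActionOfHom` along `x ↦ x ≫ φ_T` — the SAME automorphisms as ★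
`translationActionMulN` of `B_T[n](T)` at the images, definitionally, which is the pattern of ★ `weilUnit_baseChange`), `hι :=` translation naturality
(★ `translation_left_comp_hom_left`), and the two ★ `weilUnit_spec` trivialisations.

WHAT IS HERE:
* §1 `comp_baseChangeHom_pow_eq_one` (`φ_T x` is `n`-torsion), `translationActionMulN_autHom_comp_baseChangeHom_left` (`t_x ≫ φ_T = φ_T ≫ t_{φ_T x}` on
  total spaces — the `hι`);
* §2 `DualPair.pow_comp_dualIsogenyOver_eq_one` (`(c ≫ φ^∨)^n = 1` when `φ^∨` is a homomorphism — ★ `isMonHom_dualIsogenyOver` under the unit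
  hypotheses), **`DualPair.weilUnit_comp_dualIsogenyOver`** — `DA.weilUnit hDA n f (c ≫ φ^∨) _ x = DB.weilUnit hDB n f c hc ⟨x ≫ φ_T, _⟩` (the torsion
  witness `hc′` of `c ≫ φ^∨` is a FREE hypothesis: `weilUnit` does not depend on it, so the identity rewrites at whatever proof the consumer holds).

## References
* [MumfordAV1970] D. Mumford, *Abelian Varieties* (1970), §20 (pp. 184–186, property (I)), §15 Thm. 1 (p. 143).
* [MilneAV2008] J. S. Milne, *Abelian Varieties* (2008), I §11 (the `e_m`-pairing), I §8 (pp. 36–37).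
* [GortzWedhorn2023] U. Görtz, T. Wedhorn, *Algebraic Geometry II* (2023), Def./Rem. 27.1 (p. 604) (translations and homomorphisms).
* [MumfordFogartyKirwan1994] D. Mumford, J. Fogarty, F. Kirwan, *GIT*, 3rd ed., Ch. 6 §1 Cor. 6.4 (p. 117), Ch. 7 §2 Def. 7.1 (p. 129).
-/

set_option autoImplicit false

noncomputable section

-- `TopCat.Presheaf`/`Scheme.Modules` are not reducible (as in Mathlib's `AlgebraicGeometry/Modules` and ★ `TorsionSectionPairing*`, ★ `WeilUnitOfTorsionPoint`).
set_option backward.isDefEq.respectTransparency false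

universe u

open CategoryTheory CategoryTheory.Limits AlgebraicGeometry MonoidalCategory CartesianMonoidalCategory TopologicalSpace
  Opposite
open scoped MonObj

namespace Literature.AlgebraicGeometry.AbelianSchemes.AbelianSchemeOver

open Literature.AlgebraicGeometry.RelativeSpec Literature.AlgebraicGeometry.Modules Literature.AlgebraicGeometry.Motives
  Literature.AlgebraicGeometry.RelativeSpec.ActionOver

/-! ## §1 The `φ_T`-image of a torsion section; translations are intertwined by `φ_T` -/

section Image

variable {S : Scheme.{u}} {A B : AbelianSchemeOver S} (φ : A.X ⟶ B.X) [IsMonHom φ] (n : ℕ) {T : Scheme.{u}} (f : T ⟶ S)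
  [IsCommMonObj (A.baseChange f).X]

/-- **`φ_T x` is `n`-torsion for an `n`-torsion section `x` of `A_T`** (`φ_T = φ ×_S T` is a homomorphism, ★ `isMonHom_baseChangeHom`; `(x ≫ φ_T)^n =
x^n ≫ φ_T`). [cite: MumfordFogartyKirwan1994, Ch. 6 §1 Corollary 6.4 (p. 117)] [cite: MumfordFogartyKirwan1994, Ch. 7 §2 Definition 7.1 (p. 129)] -/
theorem comp_baseChangeHom_pow_eq_one (x : (A.baseChange f).torsionSections n) :
    ((x : (A.baseChange f).Sections) ≫ baseChangeHom φ f) ^ n = 1 := by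
  haveI := isMonHom_baseChangeHom φ f
  rw [← MonObj.pow_comp, (A.baseChange f).torsionSections_pow n x, MonObj.one_comp]

variable [IsCommMonObj (B.baseChange f).X]

/-- **Translations are intertwined by `φ_T`: `t_x ≫ φ_T = φ_T ≫ t_{φ_T x}`** on total spaces, for the translation actions over `[n]` of `A_T[n](T)` on `A_T`
(★ `translationActionMulN`) and of `B_T[n](T)` on `B_T` at the image `φ_T x` — the hypothesis `hι` of ★ `TorsionPairing.pairingUnit_eq_of_dualIsogeny`
(★ `translation_left_comp_hom_left`). [cite: GortzWedhorn2023, Def./Rem. 27.1 (p. 604)] [cite: MumfordAV1970, §20 (p. 186)] -/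
theorem translationActionMulN_autHom_comp_baseChangeHom_left (x : (A.baseChange f).torsionSections n) :
    ((A.baseChange f).translationActionMulN n).autHom x ≫ (baseChangeHom φ f).left =
      (baseChangeHom φ f).left ≫ ((B.baseChange f).translationActionMulN n).autHom
        ⟨(x : (A.baseChange f).Sections) ≫ baseChangeHom φ f, comp_baseChangeHom_pow_eq_one φ n f x⟩ := by
  haveI := isMonHom_baseChangeHom φ f
  rw [translationActionMulN_autHom, translationActionMulN_autHom]
  exact translation_left_comp_hom_left (B.baseChange f) (A.baseChange f) (baseChangeHom φ f) (x : (A.baseChange f).Sections)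

end Image

/-! ## §2 `e_n^A(x, φ^∨ ŷ) = e_n^B(φ x, ŷ)` -/

namespace DualPair

open TorsionPairing

variable {S : Scheme.{u}} {A B : AbelianSchemeOver S} [IsReduced S] [IsLocallyNoetherian S] (φ : A.X ⟶ B.X) [IsMonHom φ]
  (DA : A.DualPair) (DB : B.DualPair)
  (hDA : Nonempty ((Scheme.Modules.pullback (DualPair.unitHatSlice DA)).obj DA.P ≅ SheafOfModules.unit _))
  (hDB : Nonempty ((Scheme.Modules.pullback (DualPair.unitHatSlice DB)).obj DB.P ≅ SheafOfModules.unit _)) (n : ℕ)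
  {T : Scheme.{u}} (f : T ⟶ S) (c : Over.mk f ⟶ DB.hat.X) (hc : c ^ n = 1)

omit [IsReduced S] [IsLocallyNoetherian S] in
include hc in
/-- **`(c ≫ φ^∨)^n = 1` for an `n`-torsion point `c` of `B̂`** when `φ^∨ : B̂ → Â` is a homomorphism (over a reduced locally Noetherian base and under the
unit hypotheses this is ★ `isMonHom_dualIsogenyOver φ DA DB hDB hDA`). [cite: MumfordAV1970, §15 Thm. 1 (p. 143)] [cite: MumfordAV1970, §20 (p. 186)] -/
theorem pow_comp_dualIsogenyOver_eq_one [IsMonHom (dualIsogenyOver φ DA DB)] : (c ≫ dualIsogenyOver φ DA DB) ^ n = 1 := by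
  rw [← MonObj.pow_comp, hc, MonObj.one_comp]

variable [IsLocallyNoetherian T] [IsCommMonObj (A.baseChange f).X] [IsCommMonObj (B.baseChange f).X]

/-- **THE WEIL UNIT IS NATURAL IN HOMOMORPHISMS — `e_n^A(x, φ^∨ ŷ) = e_n^B(φ x, ŷ)`** ([MumfordAV1970] §20 p. 186, property (I)): for a homomorphism
`φ : A → B` of abelian `S`-schemes, dual pairs with the unit hypotheses, an `n`-torsion `T`-point `ŷ = c` of `B̂` and an `n`-torsion section `x` of `A_T`,
the Weil unit of `x` against the point `c ≫ φ^∨` of `Â` (★ `dualIsogenyOver`) IS the Weil unit of the section `x ≫ φ_T` of `B_T` against `c`.  The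
torsion witness `hc′` of `c ≫ φ^∨` is a free hypothesis (`pow_comp_dualIsogenyOver_eq_one` supplies one; `weilUnit` does not depend on it).  Proof: ★
`pairingUnit_eq_of_dualIsogeny` at the translation action of `A_T[n](T)` on `A_T` and its push-forward along `φ_T` on `B_T` (★ `translationActionOfHom`
along `x ↦ x ≫ φ_T`: the same automorphisms as the translation action of `B_T[n](T)` at the images, definitionally), intertwined by §1, with the two ★
`weilUnit_spec` trivialisations. [cite: MumfordAV1970, §20 (pp. 184–186)] [cite: MilneAV2008, I §11] -/
theorem weilUnit_comp_dualIsogenyOver (hc' : (c ≫ dualIsogenyOver φ DA DB) ^ n = 1) (x : (A.baseChange f).torsionSections n) :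
    DA.weilUnit hDA n f (c ≫ dualIsogenyOver φ DA DB) hc' x =
      DB.weilUnit hDB n f c hc ⟨(x : (A.baseChange f).Sections) ≫ baseChangeHom φ f, comp_baseChangeHom_pow_eq_one φ n f x⟩ := by
  obtain ⟨eA, heA⟩ := DA.weilUnit_spec hDA n f (c ≫ dualIsogenyOver φ DA DB) hc'
  obtain ⟨eB, heB⟩ := DB.weilUnit_spec hDB n f c hc
  haveI := isMonHom_baseChangeHom φ f
  exact pairingUnit_eq_of_dualIsogeny φ DA DB f c ((A.baseChange f).translationActionMulN n)
    ((B.baseChange f).translationActionOfHom n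
      ((IsMonHom.monoidHom (baseChangeHom φ f) _).comp ((A.baseChange f).torsionSections n).subtype)
      (fun k => comp_baseChangeHom_pow_eq_one φ n f k))
    (fun k => translationActionMulN_autHom_comp_baseChangeHom_left φ n f k) eB
    (fun k => DB.weilUnit hDB n f c hc ⟨(k : (A.baseChange f).Sections) ≫ baseChangeHom φ f, comp_baseChangeHom_pow_eq_one φ n f k⟩)
    (fun k => heB ⟨(k : (A.baseChange f).Sections) ≫ baseChangeHom φ f, comp_baseChangeHom_pow_eq_one φ n f k⟩)
    eA (DA.weilUnit hDA n f (c ≫ dualIsogenyOver φ DA DB) hc') heA x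

end DualPair

end Literature.AlgebraicGeometry.AbelianSchemes.AbelianSchemeOver

end
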